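import Summits.QuantumFields.QCD.Theses.GapBuysCauchyRate

/-!
# Route `GapBuysCauchyRate`, support item `CauchySummation` (stmt-QuantumFields-11526)

Summable increments converge: if `x : ℕ → ℂ`, `r : ℕ → ℝ` is summable and
`‖x (k+1) - x k‖ ≤ C · r k` for all `k`, then `x` has a limit.  This is the elementary
"no compactness" step of the route: `ℂ` is complete, and a sequence whose consecutive distances
are dominated by a summable sequence is Cauchy (Mathlib `cauchySeq_of_dist_le_of_summable`,
`cauchySeq_tendsto_of_complete`).  No sign hypothesis on `r` or `C` is needed: `Summable` in
Mathlib is unconditional summability, which is preserved by `C * ·`, and the comparison lemma only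
uses the pointwise bound.
-/

namespace Summit.QuantumFields.QCD.Theorems

/-- **Route item `CauchySummation`** (stmt-QuantumFields-11526): for `x : ℕ → ℂ`, `r : ℕ → ℝ`
summable and `C : ℝ` with `‖x (k+1) - x k‖ ≤ C * r k` for every `k`, the sequence `x` converges.
Proof: `k ↦ C * r k` is summable (`Summable.mul_left`), so `x` is Cauchy by
`cauchySeq_of_dist_le_of_summable`, hence convergent since `ℂ` is complete. -/
theorem cauchySummation_proof :
    Summit.QuantumFields.QCD.Theses.GapBuysCauchyRate.CauchySummation := by
  unfold Summit.QuantumFields.QCD.Theses.GapBuysCauchyRate.CauchySummation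
  intro x r C hr hx
  have hcs : CauchySeq x := by
    refine cauchySeq_of_dist_le_of_summable (fun k => C * r k) (fun n => ?_) (hr.mul_left C)
    rw [dist_comm, dist_eq_norm]
    exact hx n
  exact cauchySeq_tendsto_of_complete hcs

end Summit.QuantumFields.QCD.Theorems
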